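import Summits.AtomisticToContinuum.HydrodynamicLimit.Theorems.OneFlightGossipEngineEnergyCurrentTailsAbsorbingRecursion
import Summits.AtomisticToContinuum.HydrodynamicLimit.Theorems.OneFlightGossipEngineEnergyCurrentTailsQuarticDocking
import Summits.AtomisticToContinuum.HydrodynamicLimit.Theorems.OneFlightGossipEngineEnergyCurrentTailsQuarticLedger
import Summits.AtomisticToContinuum.HydrodynamicLimit.Theorems.OneFlightGossipEngineEnergyCurrentTailsQuarticData
import Summits.AtomisticToContinuum.HydrodynamicLimit.Theorems.OneFlightGossipEngineEnergyCurrentTailsGainCeilingGlue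
import Summits.AtomisticToContinuum.HydrodynamicLimit.Theorems.OneFlightGossipEngineEnergyCurrentTailsEnergyFluxCeilingDock
import Summits.AtomisticToContinuum.HydrodynamicLimit.Theorems.OneFlightGossipEngineEnergyCurrentTailsLossIntensityFloorGlue
import Summits.AtomisticToContinuum.HydrodynamicLimit.Theorems.OneFlightGossipEngineEnergyCurrentTailsLossFloorGlue
import Summits.AtomisticToContinuum.HydrodynamicLimit.Theorems.OneFlightGossipEngineEnergyCurrentTailsLossIntensityFloorMixingGlue
import HarnessLib

/-!
# Crux `EnergyCurrentTails` (stmt-AtomisticToContinuum-9235), line `quartic-schur-ledger`: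
# the composition — the crux from its open one-sided contact primitives

This file lands §4 of the line lead's registered skeleton
`Cruxes/EnergyCurrentTails/Lines/quartic_schur_ledger.lean` over LANDED declarations only, i.e. the
kernel-checked reduction of the crux `OneFlightGossipEngine.EnergyCurrentTails` (definitionally the same
`Prop` as `WarmColdDichotomy.EnergyCurrentTails`) to the line's open primitives:

* `EnergyCurrentTails_of_lossIntensityFloor : LIF → S2a″ → EnergyCurrentTails` — the QUARTIC MAXIMUM
  PRINCIPLE: ledger L (`stub_quarticLedger`, p97111) + datum Q0 (`stub_quarticData`, p100638) + loss floor
  S1 (from the loss-intensity floor LIF by the S1-glue `stub_lossFloor_of_lossIntensityFloor`, p126987, over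
  the window floor WF p126563) + gain ceiling S2 (S2b `stub_gainCeiling_of_energyFluxCeiling`, p102356, over
  the kinetic-window dock `stub_energyFluxCeiling_of_windows`, p135409, of the all-windows energy-flux ceiling
  S2a″) feed the absorbing one-window recursion (`absorbing_recursion`), giving an `N`-uniform quartic
  velocity moment along the flow before the first shock, which the landed Chebyshev docking
  `LoschmidtTagging.stub_quarticDocking` (p92098) turns into the crux BY NAME;
* `EnergyCurrentTails_of_subs : RF₂ → SD → S2a″ → EnergyCurrentTails` — through the landed LIF′
  `stub_lossIntensityFloor_of_rateSplitFlux` (p140393): the crux from the quartic fast-particle collision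
  RATE FLOOR RF₂, the angular SPLIT-DEFICIT FLOOR SD and the bilinear ENERGY-FLUX CEILING S2a″ (the
  crux-strategist's SPLIT-REQUEST of 2026-08-17, `Cruxes/EnergyCurrentTails/SPLIT-REQUEST-EnergyCurrentTails.md`;
  this is the `--glue-by` declaration it asks for);
* `EnergyCurrentTails_of_mixingFloor : QMF → S2a″ → EnergyCurrentTails` — through the landed LIF″
  `stub_lossIntensityFloor_of_mixingFlux` (p140830): the lead's cycle-2 reshape replaces RF₂ ∧ SD by the
  single lower primitive QMF (`stub_quarticMixingFloor`, quartic mixing floor), so the line's registered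
  skeleton is CLOSED MODULO {QMF, S2a″}.

The three hypotheses are the registered open stubs of the line verbatim (skeleton `Holds.stub_fastCollisionRateQuartic`,
`Holds.stub_quarticSplitDeficit`, `Holds.stub_energyFluxCeilingWindows`; the first two survive in the
skeleton as the hypothesis types of LIF′); each is a genuine one-sided statement about contact statistics
under the evolved law (lower: rate floor, split non-degeneracy; upper: flux ceiling, typed producer
stmt-AtomisticToContinuum-16939 via the landed dock `stub_energyFluxCeilingWindows_of_oneRare`, p139311),
certified at rung 0 (`stub_fastCollisionRateQuarticRung0` p135746, `stub_quarticSplitDeficitRung0` p140148,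
`stub_energyFluxCeilingRung0` p102898).  Nothing here is new mathematics: it is the line's bookkeeping
made importable, so that the crux is displayed as CLOSED MODULO {RF₂, SD, S2a″}.

References: Bobylev 1997, Mischler–Wennberg 1999 (Povzner moment method); Cercignani–Illner–Pulvirenti
1994 §4.2 (records of the hard-sphere flow).
-/

noncomputable section

open MeasureTheory Set Filter
open scoped ENNReal

namespace Summit.AtomisticToContinuum.HydrodynamicLimit.Theorems.QuarticSchurLedger

open Literature.MathematicalPhysics.KineticTheory Literature.Analysis.FluidPDE

/-- **THE QUARTIC MAXIMUM PRINCIPLE, composed: LIF → S2a″ → `EnergyCurrentTails`** (line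
`quartic-schur-ledger`, crux stmt-AtomisticToContinuum-9235; skeleton §4 over landed declarations).
From the loss-intensity floor LIF and the all-windows energy-flux ceiling S2a″: S2a := dock(S2a″)
(`stub_energyFluxCeiling_of_windows`), S2 := S2b(Q0, S2a) (`stub_gainCeiling_of_energyFluxCeiling`),
S1 := S1-glue(S2, LIF) (`stub_lossFloor_of_lossIntensityFloor`); then for `t < T` take `(τ, c, A)` from S1,
`D` from S2 at slope `η = c/4`, `B, B′_N` from Q0 (`stub_quarticData`), and apply `absorbing_recursion` to
`y_N(r) = E[(N+1)⁻¹Σ‖vᵢ(r)‖⁴]`, `Gain_N`, `Loss_N` (exact ledger `stub_quarticLedger`) with window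
`h = τ(N+1)^{-1/3}`: `y_N(s) ≤ 2(max B (2A + 4D/c) + D)` on `[0,t]` for `N ≥ N₀`; the landed Chebyshev
docking `LoschmidtTagging.stub_quarticDocking` concludes the crux by name. [folklore] -/
theorem EnergyCurrentTails_of_lossIntensityFloor :
    (∀ (a₀ θ₀ : T3 → ℝ) (u₀ : T3 → V3), Continuous a₀ → Continuous θ₀ → Continuous u₀ → (∀ x, 0 < a₀ x) →
    (∀ x, 0 < θ₀ x) → ∃ σ₀ : ℝ, 0 < σ₀ ∧ ∀ σ, 0 < σ → σ < σ₀ → ∀ T, 0 < T → ∀ Φ : (N : ℕ) → HardSphereFlow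
    (Torus.geometry (Fin 3)) (hsDiameter σ N) (N+1), ∃ δ, 0 < δ ∧ ∃ K₀, 1 ≤ K₀ ∧ ∃ C, 0 ≤ C ∧ ∃ N₀, ∀ N :
    ℕ, N₀ ≤ N → ∀ s s', 0 ≤ s → s ≤ s' → s' ≤ T → ENNReal.ofReal (δ*(σ^2*((N : ℝ)+1)^(1/3 : ℝ)))*(∫⁻ r in
    Ioc s s', (∫⁻ z, ENNReal.ofReal (((N : ℝ)+1)⁻¹*∑ i, (if K₀ < ‖((Φ N).flow r z i).2‖ then ‖((Φ N).flow
    r z i).2‖^5 else 0)) ∂localGibbsLaw σ a₀ u₀ θ₀ N (Φ N))) ≤ (∫⁻ z, ENNReal.ofReal (((N : ℝ)+1)⁻¹*(Φ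
    N).collisionSum (Ioc s s') (fun col => max (‖col.preVel.1‖^4 + ‖col.preVel.2‖^4 - ‖col.postVel.1‖^4 -
    ‖col.postVel.2‖^4) 0 / 2) z) ∂localGibbsLaw σ a₀ u₀ θ₀ N (Φ N)) + ENNReal.ofReal (C*(σ^2*((N :
    ℝ)+1)^(1/3 : ℝ)*(s' - s)))*(⨆ r ∈ Icc s s', (∫⁻ z, ENNReal.ofReal (((N : ℝ)+1)⁻¹*∑ i, ‖((Φ N).flow r z
    i).2‖^2) ∂localGibbsLaw σ a₀ u₀ θ₀ N (Φ N)))*(⨆ r ∈ Icc s s', (∫⁻ z, ENNReal.ofReal (((N : ℝ)+1)⁻¹*∑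
    i, ‖((Φ N).flow r z i).2‖^3) ∂localGibbsLaw σ a₀ u₀ θ₀ N (Φ N)))) → (∀ (a₀ θ₀ : T3 → ℝ) (u₀ : T3 →
    V3), Continuous a₀ → Continuous θ₀ → Continuous u₀ → (∀ x, 0 < a₀ x) → (∀ x, 0 < θ₀ x) → ∃ σ₀ : ℝ, 0 <
    σ₀ ∧ ∀ σ, 0 < σ → σ < σ₀ → ∀ T, 0 < T → ∀ Φ : (N : ℕ) → HardSphereFlow (Torus.geometry (Fin 3))
    (hsDiameter σ N) (N+1), ∃ C, 0 ≤ C ∧ ∃ N₀, ∀ N : ℕ, N₀ ≤ N → ∀ s s', 0 ≤ s → s ≤ s' → s' ≤ T → (∫⁻ z,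
    ENNReal.ofReal (((N : ℝ)+1)⁻¹*(Φ N).collisionSum (Ioc s s') (fun col =>
    ‖col.preVel.1‖^2*‖col.preVel.2‖^2) z) ∂localGibbsLaw σ a₀ u₀ θ₀ N (Φ N)) ≤ ENNReal.ofReal (C*(σ^2*((N
    : ℝ)+1)^(1/3 : ℝ)*(s' - s)))*(⨆ r ∈ Icc s s', (∫⁻ z, ENNReal.ofReal (((N : ℝ)+1)⁻¹*∑ i, ‖((Φ N).flow r
    z i).2‖^2) ∂localGibbsLaw σ a₀ u₀ θ₀ N (Φ N)))*(⨆ r ∈ Icc s s', (∫⁻ z, ENNReal.ofReal (((N : ℝ)+1)⁻¹*∑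
    i, ‖((Φ N).flow r z i).2‖^3) ∂localGibbsLaw σ a₀ u₀ θ₀ N (Φ N)))) →
    Summit.AtomisticToContinuum.HydrodynamicLimit.Theses.OneFlightGossipEngine.EnergyCurrentTails := by
  intro hLIF hW
  -- the two derived crux-frame stubs S2 (gain ceiling) and S1 (loss floor), from landed glue
  have h2 := stub_gainCeiling_of_energyFluxCeiling stub_quarticData (stub_energyFluxCeiling_of_windows hW)
  have h1 := stub_lossFloor_of_lossIntensityFloor h2 hLIF
  refine Summit.AtomisticToContinuum.HydrodynamicLimit.Theorems.LoschmidtTagging.stub_quarticDocking ?_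
  -- C⁺: the N-uniform quartic moment along the flow before the first shock
  intro a₀ θ₀ u₀ ha hθ hu ha0 hθ0
  obtain ⟨σ₁, hσ₁, H1⟩ := h1 a₀ θ₀ u₀ ha hθ hu ha0 hθ0
  obtain ⟨σ₂, hσ₂, H2⟩ := h2 a₀ θ₀ u₀ ha hθ hu ha0 hθ0
  obtain ⟨σ₃, hσ₃, H3⟩ := stub_quarticData a₀ θ₀ u₀ ha hθ hu ha0 hθ0
  refine ⟨min (min σ₁ σ₂) (min σ₃ (1 / 2)),
    lt_min (lt_min hσ₁ hσ₂) (lt_min hσ₃ (by norm_num)), ?_⟩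
  intro σ hσ hσlt T ρ θ u hE Φ h0 t ht
  have hσ₁' : σ < σ₁ := lt_of_lt_of_le hσlt ((min_le_left _ _).trans (min_le_left _ _))
  have hσ₂' : σ < σ₂ := lt_of_lt_of_le hσlt ((min_le_left _ _).trans (min_le_right _ _))
  have hσ₃' : σ < σ₃ := lt_of_lt_of_le hσlt ((min_le_right _ _).trans (min_le_left _ _))
  have hσh : σ < 1 / 2 := lt_of_lt_of_le hσlt ((min_le_right _ _).trans (min_le_right _ _))
  obtain ⟨τ, hτ, c, hc, hc1, A, hA, N₁, HS1⟩ := H1 σ hσ hσ₁' T ρ θ u hE Φ h0 t ht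
  obtain ⟨D, hD, N₂, HS2⟩ := H2 σ hσ hσ₂' T ρ θ u hE Φ h0 t ht τ hτ (c / 4) (by positivity)
  obtain ⟨B, hB, N₃, HQ⟩ := H3 σ hσ hσ₃' Φ
  refine ⟨2 * (max B (2 * A + 4 * D / c) + D), max N₁ (max N₂ N₃), fun N hN s hs => ?_⟩
  have hN₁ : N₁ ≤ N := le_trans (le_max_left _ _) hN
  have hN₂ : N₂ ≤ N := le_trans ((le_max_left _ _).trans (le_max_right _ _)) hN
  have hN₃ : N₃ ≤ N := le_trans ((le_max_right _ _).trans (le_max_right _ _)) hN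
  obtain ⟨hQ0, B', hB'⟩ := HQ N hN₃
  have hh : 0 < τ * ((N : ℝ) + 1) ^ (-(1 / 3 : ℝ)) := by positivity
  exact absorbing_recursion
    (y := fun r => ∫⁻ z, ENNReal.ofReal (((N : ℝ) + 1)⁻¹ * ∑ i : Fin (N + 1), ‖((Φ N).flow r z i).2‖ ^ 4)
      ∂(localGibbsLaw σ a₀ u₀ θ₀ N (Φ N)))
    (G := fun s s' => ∫⁻ z, ENNReal.ofReal (((N : ℝ) + 1)⁻¹ *
      (Φ N).collisionSum (Set.Ioc s s')
        (fun col => max (‖col.postVel.1‖ ^ 4 + ‖col.postVel.2‖ ^ 4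
          - ‖col.preVel.1‖ ^ 4 - ‖col.preVel.2‖ ^ 4) 0 / 2) z) ∂(localGibbsLaw σ a₀ u₀ θ₀ N (Φ N)))
    (L := fun s s' => ∫⁻ z, ENNReal.ofReal (((N : ℝ) + 1)⁻¹ *
      (Φ N).collisionSum (Set.Ioc s s')
        (fun col => max (‖col.preVel.1‖ ^ 4 + ‖col.preVel.2‖ ^ 4
          - ‖col.postVel.1‖ ^ 4 - ‖col.postVel.2‖ ^ 4) 0 / 2) z) ∂(localGibbsLaw σ a₀ u₀ θ₀ N (Φ N)))
    (t := t) hh hc hc1 hA hD (by positivity) le_rfl hB hB' hQ0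
    (fun s₁ s₂ hs₁ hs₁₂ => stub_quarticLedger a₀ θ₀ u₀ σ hσ hσh N (Φ N) s₁ s₂ hs₁ hs₁₂)
    (HS1 N hN₁) (HS2 N hN₂) s hs

/-- **The crux from its three open contact primitives: RF₂ → SD → S2a″ → `EnergyCurrentTails`**
(line `quartic-schur-ledger`, crux stmt-AtomisticToContinuum-9235; the crux-strategist's SPLIT glue).
RF₂ = quartic fast-particle collision rate floor (one rare participant), SD = E²-weighted angular split
deficit (bulk ratio), S2a″ = all-windows bilinear energy-flux ceiling (bulk; typed producer
stmt-AtomisticToContinuum-16939) — the registered stubs `stub_fastCollisionRateQuartic`,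
`stub_quarticSplitDeficit`, `stub_energyFluxCeilingWindows` verbatim.  Proof: the landed LIF′
`stub_lossIntensityFloor_of_rateSplitFlux` and `EnergyCurrentTails_of_lossIntensityFloor`. [folklore] -/
theorem EnergyCurrentTails_of_subs :
    (∀ (a₀ θ₀ : T3 → ℝ) (u₀ : T3 → V3), Continuous a₀ → Continuous θ₀ → Continuous u₀ → (∀ x, 0 < a₀ x) →
    (∀ x, 0 < θ₀ x) → ∃ σ₀ : ℝ, 0 < σ₀ ∧ ∀ σ, 0 < σ → σ < σ₀ → ∀ T, 0 < T → ∀ Φ : (N : ℕ) → HardSphereFlow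
    (Torus.geometry (Fin 3)) (hsDiameter σ N) (N+1), ∃ K₀, 0 ≤ K₀ ∧ ∃ c, 0 < c ∧ ∃ N₀, ∀ N, N₀ ≤ N → ∀ s
    t, 0 ≤ s → s ≤ t → t ≤ T → ENNReal.ofReal (c*(σ^2*((N+1 : ℕ) : ℝ)^((1 : ℝ)/3)))*∫⁻ τ in Ioc s t, (∫⁻
    z, ENNReal.ofReal (((N+1 : ℕ) : ℝ)⁻¹*∑ i, if K₀ < ‖((Φ N).flow τ z i).2‖ then ‖((Φ N).flow τ z i).2‖^5
    else 0) ∂localGibbsLaw σ a₀ u₀ θ₀ N (Φ N)) ≤ ∫⁻ z, (∑ᶠ τ ∈ collisionTimes (Torus.geometry (Fin 3))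
    (hsDiameter σ N) ((Φ N).flow · z) ∩ Ioc s t, ∑ i, ∑ j, if i = j then 0 else (contactSet
    (Torus.geometry (Fin 3)) _ (hsDiameter σ N) i j).indicator (fun y => if K₀ < ‖(collidePair
    (Torus.geometry (Fin 3)) i j y i).2‖ then ENNReal.ofReal (((N+1 : ℕ) : ℝ)⁻¹*‖(collidePair
    (Torus.geometry (Fin 3)) i j y i).2‖^4) else 0) ((Φ N).flow τ z)) ∂localGibbsLaw σ a₀ u₀ θ₀ N (Φ N)) →
    (∀ (a₀ θ₀ : T3 → ℝ) (u₀ : T3 → V3), Continuous a₀ → Continuous θ₀ → Continuous u₀ → (∀ x, 0 < a₀ x) →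
    (∀ x, 0 < θ₀ x) → ∃ σ₀ : ℝ, 0 < σ₀ ∧ ∀ σ, 0 < σ → σ < σ₀ → ∀ T, 0 < T → ∀ Φ : (N : ℕ) → HardSphereFlow
    (Torus.geometry (Fin 3)) (hsDiameter σ N) (N+1), ∃ δ, 0 < δ ∧ ∃ N₀, ∀ N, N₀ ≤ N → ∀ s t, 0 ≤ s → s ≤ t
    → t ≤ T → ENNReal.ofReal δ*(∫⁻ z, (∑ᶠ τ ∈ collisionTimes (Torus.geometry (Fin 3)) (hsDiameter σ N) ((Φ
    N).flow · z) ∩ Ioc s t, ∑ i, ∑ j, if i = j then 0 else (contactSet (Torus.geometry (Fin 3)) _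
    (hsDiameter σ N) i j).indicator (fun y => ENNReal.ofReal (((N+1 : ℕ) : ℝ)⁻¹*(‖(y i).2‖^2 + ‖(y
    j).2‖^2)^2)) ((Φ N).flow τ z)) ∂localGibbsLaw σ a₀ u₀ θ₀ N (Φ N)) ≤ (∫⁻ z, (∑ᶠ τ ∈ collisionTimes
    (Torus.geometry (Fin 3)) (hsDiameter σ N) ((Φ N).flow · z) ∩ Ioc s t, ∑ i, ∑ j, if i = j then 0 else
    (contactSet (Torus.geometry (Fin 3)) _ (hsDiameter σ N) i j).indicator (fun y => ENNReal.ofReal (((N+1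
    : ℕ) : ℝ)⁻¹*(2*(‖(y i).2‖^2*‖(y j).2‖^2)))) ((Φ N).flow τ z)) ∂localGibbsLaw σ a₀ u₀ θ₀ N (Φ N))) → (∀
    (a₀ θ₀ : T3 → ℝ) (u₀ : T3 → V3), Continuous a₀ → Continuous θ₀ → Continuous u₀ → (∀ x, 0 < a₀ x) → (∀
    x, 0 < θ₀ x) → ∃ σ₀ : ℝ, 0 < σ₀ ∧ ∀ σ, 0 < σ → σ < σ₀ → ∀ T, 0 < T → ∀ Φ : (N : ℕ) → HardSphereFlow
    (Torus.geometry (Fin 3)) (hsDiameter σ N) (N+1), ∃ C, 0 ≤ C ∧ ∃ N₀, ∀ N : ℕ, N₀ ≤ N → ∀ s s', 0 ≤ s →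
    s ≤ s' → s' ≤ T → (∫⁻ z, ENNReal.ofReal (((N : ℝ)+1)⁻¹*(Φ N).collisionSum (Ioc s s') (fun col =>
    ‖col.preVel.1‖^2*‖col.preVel.2‖^2) z) ∂localGibbsLaw σ a₀ u₀ θ₀ N (Φ N)) ≤ ENNReal.ofReal (C*(σ^2*((N
    : ℝ)+1)^(1/3 : ℝ)*(s' - s)))*(⨆ r ∈ Icc s s', (∫⁻ z, ENNReal.ofReal (((N : ℝ)+1)⁻¹*∑ i, ‖((Φ N).flow r
    z i).2‖^2) ∂localGibbsLaw σ a₀ u₀ θ₀ N (Φ N)))*(⨆ r ∈ Icc s s', (∫⁻ z, ENNReal.ofReal (((N : ℝ)+1)⁻¹*∑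
    i, ‖((Φ N).flow r z i).2‖^3) ∂localGibbsLaw σ a₀ u₀ θ₀ N (Φ N)))) →
    Summit.AtomisticToContinuum.HydrodynamicLimit.Theses.OneFlightGossipEngine.EnergyCurrentTails :=
  fun hRF hSD hW =>
    EnergyCurrentTails_of_lossIntensityFloor (stub_lossIntensityFloor_of_rateSplitFlux hRF hSD hW) hW

/-- **The crux from the line's two open primitives after the lead's cycle-2 reshape: QMF → S2a″ →
`EnergyCurrentTails`** (QMF = quartic mixing floor `stub_quarticMixingFloor`: lab-fast spheres collide at
rate `≥ cν‖v‖` with a mixed outgoing split, in the `‖v‖⁴`-weighted time-integrated mean; S2a″ as above).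
Proof: the landed LIF″ `stub_lossIntensityFloor_of_mixingFlux` (p140830) and
`EnergyCurrentTails_of_lossIntensityFloor`. [folklore] -/
theorem EnergyCurrentTails_of_mixingFloor :
    (∀ (a₀ θ₀ : T3 → ℝ) (u₀ : T3 → V3), Continuous a₀ → Continuous θ₀ → Continuous u₀ → (∀ x, 0 < a₀ x) →
    (∀ x, 0 < θ₀ x) → ∃ σ₀ : ℝ, 0 < σ₀ ∧ ∀ σ, 0 < σ → σ < σ₀ → ∀ T, 0 < T → ∀ Φ : (N : ℕ) → HardSphereFlow
    (Torus.geometry (Fin 3)) (hsDiameter σ N) (N+1), ∃ K₀, 0 ≤ K₀ ∧ ∃ c, 0 < c ∧ ∃ N₀, ∀ N, N₀ ≤ N → ∀ s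
    t, 0 ≤ s → s ≤ t → t ≤ T → ENNReal.ofReal (c*(σ^2*((N+1 : ℕ) : ℝ)^((1 : ℝ)/3)))*∫⁻ τ in Ioc s t, (∫⁻
    z, ENNReal.ofReal (((N+1 : ℕ) : ℝ)⁻¹*∑ i, if K₀ < ‖((Φ N).flow τ z i).2‖ then ‖((Φ N).flow τ z i).2‖^5
    else 0) ∂localGibbsLaw σ a₀ u₀ θ₀ N (Φ N)) ≤ ∫⁻ z, (∑ᶠ τ ∈ collisionTimes (Torus.geometry (Fin 3))
    (hsDiameter σ N) ((Φ N).flow · z) ∩ Ioc s t, ∑ i, ∑ j, if i = j then 0 else (contactSet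
    (Torus.geometry (Fin 3)) _ (hsDiameter σ N) i j).indicator (fun y => if K₀ < ‖(collidePair
    (Torus.geometry (Fin 3)) i j y i).2‖ then ENNReal.ofReal (((N+1 : ℕ) : ℝ)⁻¹*(2*(‖(y i).2‖^2*‖(y
    j).2‖^2))) else 0) ((Φ N).flow τ z)) ∂localGibbsLaw σ a₀ u₀ θ₀ N (Φ N)) → (∀ (a₀ θ₀ : T3 → ℝ) (u₀ : T3
    → V3), Continuous a₀ → Continuous θ₀ → Continuous u₀ → (∀ x, 0 < a₀ x) → (∀ x, 0 < θ₀ x) → ∃ σ₀ : ℝ, 0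
    < σ₀ ∧ ∀ σ, 0 < σ → σ < σ₀ → ∀ T, 0 < T → ∀ Φ : (N : ℕ) → HardSphereFlow (Torus.geometry (Fin 3))
    (hsDiameter σ N) (N+1), ∃ C, 0 ≤ C ∧ ∃ N₀, ∀ N : ℕ, N₀ ≤ N → ∀ s s', 0 ≤ s → s ≤ s' → s' ≤ T → (∫⁻ z,
    ENNReal.ofReal (((N : ℝ)+1)⁻¹*(Φ N).collisionSum (Ioc s s') (fun col =>
    ‖col.preVel.1‖^2*‖col.preVel.2‖^2) z) ∂localGibbsLaw σ a₀ u₀ θ₀ N (Φ N)) ≤ ENNReal.ofReal (C*(σ^2*((N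
    : ℝ)+1)^(1/3 : ℝ)*(s' - s)))*(⨆ r ∈ Icc s s', (∫⁻ z, ENNReal.ofReal (((N : ℝ)+1)⁻¹*∑ i, ‖((Φ N).flow r
    z i).2‖^2) ∂localGibbsLaw σ a₀ u₀ θ₀ N (Φ N)))*(⨆ r ∈ Icc s s', (∫⁻ z, ENNReal.ofReal (((N : ℝ)+1)⁻¹*∑
    i, ‖((Φ N).flow r z i).2‖^3) ∂localGibbsLaw σ a₀ u₀ θ₀ N (Φ N)))) →
    Summit.AtomisticToContinuum.HydrodynamicLimit.Theses.OneFlightGossipEngine.EnergyCurrentTails :=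
  fun hQMF hW =>
    EnergyCurrentTails_of_lossIntensityFloor (stub_lossIntensityFloor_of_mixingFlux hQMF hW) hW

end Summit.AtomisticToContinuum.HydrodynamicLimit.Theorems.QuarticSchurLedger

end
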